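import Summits.BirchSwinnertonDyer.Rank1Residual.X12.O11.RamifiedStrictDescent
import Summits.BirchSwinnertonDyer.BirchSwinnertonDyer.Theses.RamifiedSevenEllipticUnits
import Summits.BirchSwinnertonDyer.Rank1Residual.X11b.AnticyclotomicEulerChar
import Summits.BirchSwinnertonDyer.Rank1Residual.X11b.AnticyclotomicModuleFinite
import HarnessLib

set_option linter.dupNamespace false
set_option autoImplicit false

/-!
# Route `RamifiedSevenEllipticUnits` (rung K7r), crux `EllipticUnitIndexSeven`
# (stmt-BirchSwinnertonDyer-19143): the crux WITH NO `Λ`-MODULE LEFT IN IT — `(R-EU)@p` is an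
# identity for the finite group `H⁰(Γ, Sel_str(K^ac_∞, E[p^∞]))` (support lemmas, `--supports 19143`)

Cell `bsd-cm`, seat `bsd-cm-k7r-c2` (g0). HONEST FRAMING: nothing here closes the crux. The typed
input `(R-EU)` = `O11.RamifiedCMEllipticUnitIndexAt W p` (`X12/O11/RamifiedStrictDescent.lean`) reads,
under the O11 frame and generator data: for every `n₀` with "`X = X_ac^∅(E[p^∞])` is `Λ`-torsion,
`Ch_Λ(X) = (f)`, `f(0) ≠ 0`, `ord_p f(0) = n₀`" (`AcSelmer.XAc.HasCharValuationAt … n₀`) and `X[T]`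
finite, `n₀ + log_p #X[T] = n + n' + ord_p #Ш_an(W) + ord_p #Ш_an(W')`. This file proves, for the
REAL module of the tree, that the left-hand side is a `Γ`-Euler characteristic with the `H¹`-term
cancelled, so that the crux is EQUIVALENT to a statement mentioning no Iwasawa algebra, no
characteristic ideal and no power series:

* §1 `forall_hasCharValuationAt_imp_iff_card` (any elliptic `V/K`, any `ℤ_p`-extension `κ`, any
  `𝔭`, `Σ = ∅`, any target value `R`):
  `(∀ n₀, HasCharValuationAt … n₀ → X[T] finite → n₀ + log_p #X[T] = R) ↔
   (H⁰(Γ, Sel) finite → log_p #H⁰(Γ, Sel) = R)`, `Sel = Sel_𝔭^∅(K_∞, E[p^∞])`,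
  `H⁰(Γ, Sel) = Sel^{γ} = IwasawaDual.endInvariants (conj_γ − 1)`. INPUTS (all kernel theorems of the
  sibling cell's X11b files, on objects definitionally equal to the Literature ones — §0 records the
  `rfl` bridges): Greenberg's Lemma 4.2 with converse `XAc.card_of_hasCharValuationAt` /
  `XAc.exists_hasCharValuationAt_of_finite` (`#Sel^γ = p^{n₀} · #Sel_γ`), Pontryagin duality
  `XAc.natCard_invariants_eq` (`#X[T] = #Sel_γ`), `XAc.finite_invariants_iff`, and finite generation
  `XAc.module_finite_empty` (Nakayama). Arithmetic: `log_p (p^{n₀} · #Sel_γ) = n₀ + log_p #X[T]`.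
* §2 `ramifiedCMEllipticUnitIndexAt_iff_card`: `(R-EU)@(W, p) ↔` [same frame / generator / `#Ш_an`
  binders] `H⁰(Γ, Sel_str(K^ac_∞, E[p^∞])) finite → ord_p #H⁰(Γ, Sel_str(K^ac_∞, E[p^∞])) =
  n + n' + ord_p #Ш_an(W) + ord_p #Ш_an(W')`.
* §3 `ellipticUnitIndexSeven_iff_card`: the route item `EllipticUnitIndexSeven` (`p = 7`, all of 𝒞₇)
  in the same `Λ`-free form.

So the crux says: for every `W ∈ 𝒞₇` (with its frame twin `W' ≅ W^{(−7)}`, generators of levels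
`n, n'` in `E(ℚ_7)`), the group of `Γ`-INVARIANT classes of the strict anticyclotomic Selmer group
over `K^ac_∞` has order `7^{n + n'} · |#Ш_an(W) · #Ш_an(W')|_7^{-1}`. Combined with exact control
(`(R-ctrl)`, item 19145: `#H⁰(Γ, Sel_str(K^ac_∞)) = #Sel_str(W/ℚ)[7^∞] · #Sel_str(W'/ℚ)[7^∞]`, the
`Λ`-free form being seat k7r-c4's) and the discharged index theorem `strictSelmerIndexAt_holds`
(`#Sel_str(E/ℚ)[p^∞] = p^n · #Ш(E/ℚ)[p^∞]`) this is `BSD(W, 7) ∧ BSD(W', 7)` (p409726) — the open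
ramified-prime value formula (★_an). Nothing is asserted; no named fact is minted; nothing closes.

References: [GreenbergLNM1716] §4 Lemma 4.2 (p. 102), §1 p. 60; [CoatesSchneiderSujatha2003] §3
(30)–(31); [Castella2018] Def. 2.2, Thm. 2.3 (arXiv:1704.06608 p. 5); [BurungaleKobayashiNakamuraOta2026]
Thm. 3.14 (3), §1.4 (arXiv:2608.06879 pp. 24, 8) (shape only; preprint); [Miller2011LMS] Def. 1.1.
-/

noncomputable section

open scoped Classical

open WeierstrassCurve NumberField IsDedekindDomain Field PowerSeries
  Literature.NumberTheory.EllipticCurves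
  Literature.NumberTheory.EllipticCurves.Rank1Residual
  Literature.NumberTheory.GaloisRepresentations
  Summit.BirchSwinnertonDyer.Rank1Residual.X12.O11
  Summit.BirchSwinnertonDyer.BirchSwinnertonDyer.Theses.RamifiedSevenEllipticUnits

namespace Summit.BirchSwinnertonDyer.BirchSwinnertonDyer.Theorems.RamifiedSevenEllipticUnits

/-! ## §0 Currency bridges: the Literature objects `Castella2018.AcSelmer.*` ARE the X11b objects -/

section Bridge

variable {K : Type} [Field K] [NumberField K] (V : WeierstrassCurve K) (p : ℕ) [Fact p.Prime]
  (κ : ZpExtension K p) (𝔭 : HeightOneSpectrum (𝓞 K)) (S : Set (HeightOneSpectrum (𝓞 K)))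
  (γ : absoluteGaloisGroup K) [Fact (κ.IsTopGenerator γ)]

omit [Fact (κ.IsTopGenerator γ)] in
/-- The Literature `Γ`-action `conj_γ` on `Sel_𝔭^Σ(K_∞, E[p^∞])` is the X11b one (both are the
restriction of the Literature `conjH1 γ`; checked pointwise). [cite: Castella2018, §2.1–2.2 (arXiv:1704.06608 p. 5)] -/
theorem conjSelmerAc_eq_x11b :
    Castella2018.AcSelmer.conjSelmerAc V p κ 𝔭 S γ =
      Summit.BirchSwinnertonDyer.Rank1Residual.X11b.AcSelmer.conjSelmerAc V p κ 𝔭 S γ := by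
  refine DFunLike.ext _ _ fun s => Subtype.ext ?_
  rw [Castella2018.AcSelmer.coe_conjSelmerAc_apply]
  exact (Summit.BirchSwinnertonDyer.Rank1Residual.X11b.AcSelmer.coe_conjSelmerAc_apply
    V p κ 𝔭 S γ s).symm

/-- The Literature shape `XAc.HasCharValuationAt` is the X11b one (`Iff.rfl`; cf.
`X11b.AcSelmer.hasCharValuationAt_iff_literature`). [cite: Castella2018, Thm. 2.3 (arXiv:1704.06608 p. 5)] -/
theorem hasCharValuationAt_iff_x11b (n : ℕ) :
    Castella2018.AcSelmer.XAc.HasCharValuationAt V p κ 𝔭 S γ n ↔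
      Summit.BirchSwinnertonDyer.Rank1Residual.X11b.AcSelmer.XAc.HasCharValuationAt V p κ 𝔭 S γ n :=
  Iff.rfl

/-- The `T`-torsion `X[T]` of the Literature module, as the subtype used by the O11 inputs, has the
cardinality of the X11b `Γ`-invariants `IwasawaAlgebra.invariants p X` (same underlying set).
[cite: GreenbergLNM1716, §1 p. 60] -/
theorem natCard_XTorsion_eq_x11b :
    Nat.card {x : Castella2018.AcSelmer.XAc V p κ 𝔭 S γ //
        (PowerSeries.X : IwasawaAlgebra p) • x = 0} =
      Nat.card (IwasawaAlgebra.invariants p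
        (Summit.BirchSwinnertonDyer.Rank1Residual.X11b.AcSelmer.XAc V p κ 𝔭 S γ)) :=
  Nat.card_congr (Equiv.subtypeEquiv
    (Equiv.refl (Castella2018.AcSelmer.XAc V p κ 𝔭 S γ))
    fun x => (IwasawaAlgebra.mem_invariants_iff p _ x).symm)

/-- … and is finite iff the X11b `Γ`-invariants are. [cite: GreenbergLNM1716, §1 p. 60] -/
theorem finite_XTorsion_iff_x11b :
    Finite {x : Castella2018.AcSelmer.XAc V p κ 𝔭 S γ //
        (PowerSeries.X : IwasawaAlgebra p) • x = 0} ↔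
      Finite (IwasawaAlgebra.invariants p
        (Summit.BirchSwinnertonDyer.Rank1Residual.X11b.AcSelmer.XAc V p κ 𝔭 S γ)) :=
  Equiv.finite_iff (Equiv.subtypeEquiv
    (Equiv.refl (Castella2018.AcSelmer.XAc V p κ 𝔭 S γ))
    fun x => (IwasawaAlgebra.mem_invariants_iff p _ x).symm)

end Bridge

/-! ## §1 The `Λ`-side of `(R-EU)` is a `Γ`-Euler characteristic with the `H¹`-term cancelled -/

section Core

open Summit.BirchSwinnertonDyer.Rank1Residual.X11b.AcSelmer
  Literature.NumberTheory.EllipticCurves.IwasawaDual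

variable {K : Type} [Field K] [NumberField K] (V : WeierstrassCurve K) [V.IsElliptic] (p : ℕ)
  [Fact p.Prime] (κ : ZpExtension K p) (𝔭 : HeightOneSpectrum (𝓞 K))
  (γ : absoluteGaloisGroup K) [Fact (κ.IsTopGenerator γ)]

/-- Valuation bookkeeping: `log_p (p^a · m) = a + log_p m` for `m ≠ 0`. [folklore] -/
theorem padicValNat_pow_mul {a m : ℕ} (hm : m ≠ 0) :
    padicValNat p (p ^ a * m) = a + padicValNat p m := by
  have hp : p.Prime := Fact.out
  rw [padicValNat.mul (pow_ne_zero _ hp.ne_zero) hm, padicValNat.prime_pow]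

/-- **The `Λ`-side of `(R-EU)` / `(R-ctrl)` with the `H¹(Γ, Sel)`-term cancelled** (X11b currency).
For `X = X_ac^∅(E[p^∞])` (finitely generated: `XAc.module_finite_empty`) and `Sel = Sel_𝔭^∅(K_∞, E[p^∞])`
with `γ` acting by `conj_γ`, and ANY integer `R`:
`(∀ n₀, "ord_p f(0) = n₀" → X[T] finite → n₀ + log_p #X[T] = R) ↔ (Sel^γ finite → log_p #Sel^γ = R)`.
(→): if `Sel^γ` is finite, Greenberg's criterion gives an `n₀` (`exists_hasCharValuationAt_of_finite`),
Lemma 4.2 gives `#Sel^γ = p^{n₀} · #Sel_γ` with `Sel_γ` finite (`card_of_hasCharValuationAt`,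
`eulerChar`), and `#X[T] = #Sel_γ` (`natCard_invariants_eq`); (←): `"ord_p f(0) = n₀"` forces `Sel^γ`
finite with the same count. [cite: GreenbergLNM1716, §4 Lemma 4.2 (p. 102)]
[cite: CoatesSchneiderSujatha2003, §3 (30)–(31)] -/
theorem forall_hasCharValuationAt_imp_iff_card (R : ℤ) :
    (∀ n₀ : ℕ, XAc.HasCharValuationAt V p κ 𝔭 ∅ γ n₀ →
      Finite (IwasawaAlgebra.invariants p (XAc V p κ 𝔭 ∅ γ)) →
        (n₀ : ℤ) + padicValNat p (Nat.card (IwasawaAlgebra.invariants p (XAc V p κ 𝔭 ∅ γ))) = R) ↔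
    (Finite (endInvariants (conjSelmerAc V p κ 𝔭 ∅ γ - 1)) →
      (padicValNat p (Nat.card (endInvariants (conjSelmerAc V p κ 𝔭 ∅ γ - 1))) : ℤ) = R) := by
  haveI : Module.Finite (IwasawaAlgebra p) (XAc V p κ 𝔭 ∅ γ) := XAc.module_finite_empty κ 𝔭 γ
  constructor
  · intro h hfin
    obtain ⟨n₀, hn₀⟩ := XAc.exists_hasCharValuationAt_of_finite V p κ 𝔭 ∅ γ hfin
    obtain ⟨_, hcard⟩ := XAc.card_of_hasCharValuationAt V p κ 𝔭 ∅ γ hn₀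
    have hn₀' := hn₀
    obtain ⟨hT, f, hf, -, -⟩ := hn₀'
    obtain ⟨hcofin, -, -, -⟩ := XAc.eulerChar V p κ 𝔭 ∅ γ hT f hf hfin
    haveI := hcofin
    have hfinT : Finite (IwasawaAlgebra.invariants p (XAc V p κ 𝔭 ∅ γ)) :=
      (XAc.finite_invariants_iff V p κ 𝔭 ∅ γ).mpr hcofin
    have e := h n₀ hn₀ hfinT
    rw [XAc.natCard_invariants_eq] at e
    have hne : Nat.card (EndCoinvariants (conjSelmerAc V p κ 𝔭 ∅ γ - 1)) ≠ 0 :=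
      Nat.card_pos.ne'
    rw [hcard, padicValNat_pow_mul p hne, Nat.cast_add]
    exact e
  · intro h n₀ hn₀ hfinT
    obtain ⟨hfin, hcard⟩ := XAc.card_of_hasCharValuationAt V p κ 𝔭 ∅ γ hn₀
    have e := h hfin
    have hcofin : Finite (EndCoinvariants (conjSelmerAc V p κ 𝔭 ∅ γ - 1)) :=
      (XAc.finite_invariants_iff V p κ 𝔭 ∅ γ).mp hfinT
    have hne : Nat.card (EndCoinvariants (conjSelmerAc V p κ 𝔭 ∅ γ - 1)) ≠ 0 :=
      Nat.card_pos.ne'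
    rw [hcard, padicValNat_pow_mul p hne, Nat.cast_add, ← XAc.natCard_invariants_eq] at e
    exact e

end Core

/-! ## §2 `(R-EU)` at a pair `(W, p)` in `Λ`-free form -/

section Pair

open Literature.NumberTheory.EllipticCurves.IwasawaDual
  Literature.NumberTheory.EllipticCurves.Castella2018

variable (W : WeierstrassCurve ℚ) [W.IsElliptic] (p : ℕ) [Fact p.Prime]

/-- **`(R-EU)@(W, p)` WITH NO `Λ`-MODULE IN IT.** The typed input
`O11.RamifiedCMEllipticUnitIndexAt W p` holds if and only if, for every O11 frame
`(K, 𝔭, W', C)` of `(W, p)` with `r_an(W) = 1`, every anticyclotomic `ℤ_p`-extension `κ` of `K` with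
topological generator `γ`, generators `P, P'` of `W(ℚ), W'(ℚ)` modulo torsion of exact
`p`-divisibility levels `n, n'` in `W(ℚ_p), W'(ℚ_p)` (no `p`-torsion there) and `#Ш_an(W) = q`,
`#Ш_an(W') = q'`: IF the group of `Γ`-invariants `H⁰(Γ, Sel_str(K^ac_∞, E[p^∞]))`
(`endInvariants (conj_γ − 1)` of Castella's strict-at-`𝔭` Selmer group `Sel_𝔭^∅(K_∞, E[p^∞])`) is
finite, THEN `ord_p #H⁰(Γ, Sel_str(K^ac_∞, E[p^∞])) = n + n' + ord_p q + ord_p q'`. (§1 applied under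
the common binder prefix; the O11 subtype `{x : X // T·x = 0}` is `X[T]` by §0.)
[cite: GreenbergLNM1716, §4 Lemma 4.2 (p. 102)] [cite: Castella2018, Def. 2.2 and Thm. 2.3 (arXiv:1704.06608 p. 5)]
[cite: BurungaleKobayashiNakamuraOta2026, Thm. 3.14 (3) and §1.4 (arXiv:2608.06879 pp. 24, 8) (shape only)] -/
theorem ramifiedCMEllipticUnitIndexAt_iff_card :
    RamifiedCMEllipticUnitIndexAt W p ↔
    ∀ (K : Type) [Field K] [NumberField K] (𝔭 : HeightOneSpectrum (𝓞 K))
      (W' : WeierstrassCurve ℚ) [W'.IsElliptic] [W'.IsGloballyMinimal] (C : VariableChange ℚ),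
      IsFrame W p K 𝔭 W' C → W.analyticRank = 1 →
      ∀ (κ : ZpExtension K p), κ.IsAnticyclotomic →
        ∀ (γ : absoluteGaloisGroup K) [Fact (κ.IsTopGenerator γ)]
          (P : W.toAffine.Point) (n : ℕ) (P' : W'.toAffine.Point) (n' : ℕ),
          ¬ IsOfFinAddOrder P →
          (∀ R : W.toAffine.Point, ∃ (k : ℤ) (T : W.toAffine.Point),
            IsOfFinAddOrder T ∧ R = k • P + T) →
          (∀ Q : (W.baseChange ℚ_[p]).toAffine.Point, p • Q = 0 → Q = 0) →
          (∃ Q : (W.baseChange ℚ_[p]).toAffine.Point, p ^ n • Q = W.toPadicPoint p P) →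
          (∀ Q : (W.baseChange ℚ_[p]).toAffine.Point, p ^ (n + 1) • Q ≠ W.toPadicPoint p P) →
          ¬ IsOfFinAddOrder P' →
          (∀ R : W'.toAffine.Point, ∃ (k : ℤ) (T : W'.toAffine.Point),
            IsOfFinAddOrder T ∧ R = k • P' + T) →
          (∀ Q : (W'.baseChange ℚ_[p]).toAffine.Point, p • Q = 0 → Q = 0) →
          (∃ Q : (W'.baseChange ℚ_[p]).toAffine.Point, p ^ n' • Q = W'.toPadicPoint p P') →
          (∀ Q : (W'.baseChange ℚ_[p]).toAffine.Point, p ^ (n' + 1) • Q ≠ W'.toPadicPoint p P') →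
          ∀ (q q' : ℚ), shaAn W = (q : ℂ) → shaAn W' = (q' : ℂ) →
            Finite (endInvariants
              (AcSelmer.conjSelmerAc (W.baseChange K) p κ 𝔭 ∅ γ - 1)) →
            (padicValNat p (Nat.card (endInvariants
              (AcSelmer.conjSelmerAc (W.baseChange K) p κ 𝔭 ∅ γ - 1))) : ℤ) =
              (n : ℤ) + n' + padicValRat p q + padicValRat p q' := by
  constructor
  · intro h K _ _ 𝔭 W' _ _ C hF hr κ hκ γ _ P n P' n' h1 h2 h3 h4 h5 h6 h7 h8 h9 h10 q q' hq hq'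
    haveI : (W.baseChange K).IsElliptic := by rw [baseChange]; infer_instance
    rw [conjSelmerAc_eq_x11b]
    refine (forall_hasCharValuationAt_imp_iff_card (W.baseChange K) p κ 𝔭 γ _).mp ?_
    intro n₀ hn₀ hfinT
    have e := h K 𝔭 W' C hF hr κ hκ γ P n P' n' h1 h2 h3 h4 h5 h6 h7 h8 h9 h10 q q' hq hq' n₀
      ((hasCharValuationAt_iff_x11b (W.baseChange K) p κ 𝔭 ∅ γ n₀).mpr hn₀)
      ((finite_XTorsion_iff_x11b (W.baseChange K) p κ 𝔭 ∅ γ).mpr hfinT)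
    rwa [natCard_XTorsion_eq_x11b] at e
  · intro h K _ _ 𝔭 W' _ _ C hF hr κ hκ γ _ P n P' n' h1 h2 h3 h4 h5 h6 h7 h8 h9 h10 q q' hq hq'
      n₀ hn₀ hfinT
    haveI : (W.baseChange K).IsElliptic := by rw [baseChange]; infer_instance
    have h' := h K 𝔭 W' C hF hr κ hκ γ P n P' n' h1 h2 h3 h4 h5 h6 h7 h8 h9 h10 q q' hq hq'
    rw [conjSelmerAc_eq_x11b] at h'
    have e := (forall_hasCharValuationAt_imp_iff_card (W.baseChange K) p κ 𝔭 γ _).mpr h' n₀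
      ((hasCharValuationAt_iff_x11b (W.baseChange K) p κ 𝔭 ∅ γ n₀).mp hn₀)
      ((finite_XTorsion_iff_x11b (W.baseChange K) p κ 𝔭 ∅ γ).mp hfinT)
    rwa [← natCard_XTorsion_eq_x11b] at e

end Pair

/-! ## §3 The route item `EllipticUnitIndexSeven` in `Λ`-free form -/

open Literature.NumberTheory.EllipticCurves.IwasawaDual
  Literature.NumberTheory.EllipticCurves.Castella2018 in
/-- **Crux `EllipticUnitIndexSeven` (stmt-BirchSwinnertonDyer-19143) WITH NO `Λ`-MODULE IN IT.**
`(R-EU)@7` on 𝒞₇ holds iff for every globally minimal `W ∈ 𝒞₇`, every O11 frame `(K, 𝔭, W', C)` at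
`7` (so `K ≅ ℚ(√−7)`, `𝔭 = (√−7)`, `W' ≅ W^{(−7)}`), every anticyclotomic `ℤ_7`-extension `κ` with
topological generator `γ`, generators `P, P'` of levels `n, n'` and `#Ш_an(W) = q`, `#Ш_an(W') = q'`:
`H⁰(Γ, Sel_str(K^ac_∞, E[7^∞]))` finite ⟹
`ord_7 #H⁰(Γ, Sel_str(K^ac_∞, E[7^∞])) = n + n' + ord_7 q + ord_7 q'`.
[cite: GreenbergLNM1716, §4 Lemma 4.2 (p. 102)] [cite: Miller2011LMS, Def. 1.1 (arXiv:1010.2431 p. 3)]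
[cite: BurungaleKobayashiNakamuraOta2026, Thm. 3.14 (3) and §1.4 (arXiv:2608.06879 pp. 24, 8) (shape only)] -/
theorem ellipticUnitIndexSeven_iff_card :
    EllipticUnitIndexSeven ↔
    ∀ (W : WeierstrassCurve ℚ) [W.IsElliptic] [W.IsGloballyMinimal] [Fact (Nat.Prime 7)],
      Summit.BirchSwinnertonDyer.Rank1Residual.X12.ClassCSeven W →
    ∀ (K : Type) [Field K] [NumberField K] (𝔭 : HeightOneSpectrum (𝓞 K))
      (W' : WeierstrassCurve ℚ) [W'.IsElliptic] [W'.IsGloballyMinimal] (C : VariableChange ℚ),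
      IsFrame W 7 K 𝔭 W' C → W.analyticRank = 1 →
      ∀ (κ : ZpExtension K 7), κ.IsAnticyclotomic →
        ∀ (γ : absoluteGaloisGroup K) [Fact (κ.IsTopGenerator γ)]
          (P : W.toAffine.Point) (n : ℕ) (P' : W'.toAffine.Point) (n' : ℕ),
          ¬ IsOfFinAddOrder P →
          (∀ R : W.toAffine.Point, ∃ (k : ℤ) (T : W.toAffine.Point),
            IsOfFinAddOrder T ∧ R = k • P + T) →
          (∀ Q : (W.baseChange ℚ_[7]).toAffine.Point, 7 • Q = 0 → Q = 0) →
          (∃ Q : (W.baseChange ℚ_[7]).toAffine.Point, 7 ^ n • Q = W.toPadicPoint 7 P) →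
          (∀ Q : (W.baseChange ℚ_[7]).toAffine.Point, 7 ^ (n + 1) • Q ≠ W.toPadicPoint 7 P) →
          ¬ IsOfFinAddOrder P' →
          (∀ R : W'.toAffine.Point, ∃ (k : ℤ) (T : W'.toAffine.Point),
            IsOfFinAddOrder T ∧ R = k • P' + T) →
          (∀ Q : (W'.baseChange ℚ_[7]).toAffine.Point, 7 • Q = 0 → Q = 0) →
          (∃ Q : (W'.baseChange ℚ_[7]).toAffine.Point, 7 ^ n' • Q = W'.toPadicPoint 7 P') →
          (∀ Q : (W'.baseChange ℚ_[7]).toAffine.Point, 7 ^ (n' + 1) • Q ≠ W'.toPadicPoint 7 P') →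
          ∀ (q q' : ℚ), shaAn W = (q : ℂ) → shaAn W' = (q' : ℂ) →
            Finite (endInvariants
              (AcSelmer.conjSelmerAc (W.baseChange K) 7 κ 𝔭 ∅ γ - 1)) →
            (padicValNat 7 (Nat.card (endInvariants
              (AcSelmer.conjSelmerAc (W.baseChange K) 7 κ 𝔭 ∅ γ - 1))) : ℤ) =
              (n : ℤ) + n' + padicValRat 7 q + padicValRat 7 q' := by
  constructor
  · intro h W _ _ _ hC
    exact (ramifiedCMEllipticUnitIndexAt_iff_card W 7).mp (h W hC)
  · intro h W _ _ _ hC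
    exact (ramifiedCMEllipticUnitIndexAt_iff_card W 7).mpr (h W hC)

end Summit.BirchSwinnertonDyer.BirchSwinnertonDyer.Theorems.RamifiedSevenEllipticUnits

end
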